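import Summits.CriticalPhenomena.PercolationContinuityZ3.Theorems.PercNearOneGluingNoHeavyLowerTailMergeStepReduction
import HarnessLib

/-!
# `NoHeavyLowerTail` (stmt-CriticalPhenomena-4575) / `AdditiveGluing` (stmt-CriticalPhenomena-4576):
# the merge law is needed only at STRONG-DRIFT blocks (route task `nh-dp-commonrelay`, gen 1)

Support file (`--supports stmt-CriticalPhenomena-4575`).  No definitions, no named facts.

Combination of the two landed reductions of the Q9-line kernel `hres9`
(`residualKernelQ9_of_mergeStep`, …MergeStepReduction; `residualKernelQ9_of_strongDriftKernel`, …StrongDriftReduction):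
in the induction on `|S|` peeling the least `a₀`-attached vertex, a sub-block `S'` whose glued graph admits a
successful switching (some `s₀ ∈ S'` and some minimiser `a′` over `A` of `μ(· ↔ b)` in the glued graph with the star
of `s₀` killed satisfy `μ_{u/S'}(a₀ ↔ b) ≤ μ_{u/S'}(a′ ↔ b)`) is good by the designated leaf `blockKernel_of_designated`
fed by `IH9`; only STRONG-DRIFT sub-blocks (every switching fails) need the merge law.  Hence the merge step is
required only when the merged block `insert y S` has strong drift:

* `residualKernelQ9_of_mergeStepSD` : strong-drift merge step ⇒ `hres9` (verbatim);
* `additiveGluing_of_mergeStepSD`, `noHeavyLowerTail_of_mergeStepSD` : ⇒ both cruxes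
  (the plain merge step trivially implies the strong-drift one: drop the extra hypothesis).

Numerics (exact enumeration, this seat, item evidence MERGE-LAW.md): the merge law has 0 violations in > 10⁵ annealed
instances (n ≤ 9); strong-drift blocks are rare and need near-ties among ≥ 3 relays.
[cite: KozmaNitzan2024, §3.2 (Definition p. 12, Lemma 5 p. 13, Thms 4–5 pp. 12–14), Question 9 (p. 36)]
-/

namespace Summit.CriticalPhenomena.PercolationContinuityZ3.Theorems

open MeasureTheory Set
open Literature.Probability.LatticeModels (prodBernoulli)
open Literature.Probability.Percolation (BondConfig openConn openConnIn openGraph openCluster)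
open scoped BigOperators

noncomputable section
open Classical

section MergeStepSD
open Literature.Probability.LatticeModels Literature.Probability.Percolation

variable {n : ℕ}

/-- **Strong-drift merge step ⇒ the Q9-line kernel `hres9`.**  Induction on `|S|` peeling the least `a₀`-attached
vertex; sub-blocks with a successful switching are good by `blockKernel_of_designated` + `IH9`, singletons likewise,
strong-drift sub-blocks by the merge step. [cite: KozmaNitzan2024, §3.2 (Thms 4–5 pp. 12–14), Question 9 (p. 36)] -/
theorem residualKernelQ9_of_mergeStepSD
    (hM : (∀ (n : ℕ) (u : Sym2 (Fin n) → unitInterval) (A S : Finset (Fin n)) (b a₀ y : Fin n),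
      b ∈ A → Disjoint S A → y ∉ A → y ∉ S → S.Nonempty → 4 ≤ A.card → a₀ ∈ A →
      (∀ a ∈ A, (prodBernoulli u).real (openConn a₀ b) ≤ (prodBernoulli u).real (openConn a b)) →
      (∀ v ∈ insert y S, (prodBernoulli u).real (openConn v b) < (prodBernoulli u).real (openConn a₀ b)) →
      (∀ s ∈ S, (prodBernoulli u).real (openConn y a₀) ≤ (prodBernoulli u).real (openConn s a₀)) →
      (∃ a ∈ A, (prodBernoulli (fun e : Sym2 (Fin n) => if (∀ x ∈ e, x ∈ insert y S) ∧ ¬ e.IsDiag then 1 else u e)).real (openConn a b) <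
        (prodBernoulli (fun e : Sym2 (Fin n) => if (∀ x ∈ e, x ∈ insert y S) ∧ ¬ e.IsDiag then 1 else u e)).real (openConn a₀ b)) →
      (∀ s₀ ∈ insert y S, ∀ a' ∈ A,
        (∀ c ∈ A, (prodBernoulli (fun e : Sym2 (Fin n) => if s₀ ∈ e then (0 : unitInterval) else (fun e : Sym2 (Fin n) => if (∀ x ∈ e, x ∈ insert y S) ∧ ¬ e.IsDiag then 1 else u e) e)).real (openConn a' b) ≤ (prodBernoulli (fun e : Sym2 (Fin n) => if s₀ ∈ e then (0 : unitInterval) else (fun e : Sym2 (Fin n) => if (∀ x ∈ e, x ∈ insert y S) ∧ ¬ e.IsDiag then 1 else u e) e)).real (openConn c b)) →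
        (prodBernoulli (fun e : Sym2 (Fin n) => if (∀ x ∈ e, x ∈ insert y S) ∧ ¬ e.IsDiag then 1 else u e)).real (openConn a' b) < (prodBernoulli (fun e : Sym2 (Fin n) => if (∀ x ∈ e, x ∈ insert y S) ∧ ¬ e.IsDiag then 1 else u e)).real (openConn a₀ b)) →
      (∀ w' : Sym2 (Fin n) → unitInterval,
        (Finset.univ.filter (fun v : Fin n => ∃ z : Fin n, 0 < (w' s(z, v) : ℝ))).card ≤
          (Finset.univ.filter (fun v : Fin n => ∃ z : Fin n,
            0 < ((fun e : Sym2 (Fin n) => if (∀ x ∈ e, x ∈ insert y S) ∧ ¬ e.IsDiag then 1 else u e) s(z, v) : ℝ))).card →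
        ∀ (A' : Finset (Fin n)) (o' b' : Fin n), b' ∈ A' → o' ∉ A' →
        ∀ c₀ : Fin n, c₀ ∈ A' →
          (∀ c ∈ A', (prodBernoulli (fun e : Sym2 (Fin n) => if o' ∈ e then (0 : unitInterval) else w' e)).real (openConn c₀ b') ≤
            (prodBernoulli (fun e : Sym2 (Fin n) => if o' ∈ e then (0 : unitInterval) else w' e)).real (openConn c b')) →
          ∀ sel' : Finset (Fin n) → Fin n, (∀ W', sel' W' ∈ A') →
          (prodBernoulli w').real (openConn c₀ b') ≤
            (prodBernoulli w').real (openConn o' b')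
              + ∑ W' ∈ (Finset.univ : Finset (Finset (Fin n))).filter (fun W' => o' ∈ W' ∧ Disjoint W' A'),
                  (prodBernoulli w').real {ω : BondConfig (Fin n) | openCluster ω o' = (W' : Set (Fin n))}
                    * (prodBernoulli w').real (openConnIn ((W' : Set (Fin n))ᶜ) (sel' W') b')) →
      (∀ sel : Finset (Fin n) → Fin n, (∀ W, sel W ∈ A) →
        ((prodBernoulli u).real (openConn a₀ b)
          + (prodBernoulli u).real ((openConn a₀ b)ᶜ ∩ (⋃ s ∈ S, openConn a₀ s) ∩ (⋃ s ∈ S, openConn s b))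
        ≤ (prodBernoulli u).real (⋃ s ∈ S, openConn s b)
          + ∑ W ∈ (Finset.univ : Finset (Finset (Fin n))).filter (fun W => Disjoint W A),
              (prodBernoulli u).real {ω : BondConfig (Fin n) | ∀ z : Fin n, (z ∈ W ↔ ω ∈ ⋃ s ∈ S, openConn s z)}
                * (prodBernoulli u).real (openConnIn ((W : Set (Fin n))ᶜ) (sel W) b))) →
      (∀ sel : Finset (Fin n) → Fin n, (∀ W, sel W ∈ A) →
        ((prodBernoulli u).real (openConn a₀ b)
          + (prodBernoulli u).real ((openConn a₀ b)ᶜ ∩ (⋃ s ∈ ({y} : Finset (Fin n)), openConn a₀ s) ∩ (⋃ s ∈ ({y} : Finset (Fin n)), openConn s b))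
        ≤ (prodBernoulli u).real (⋃ s ∈ ({y} : Finset (Fin n)), openConn s b)
          + ∑ W ∈ (Finset.univ : Finset (Finset (Fin n))).filter (fun W => Disjoint W A),
              (prodBernoulli u).real {ω : BondConfig (Fin n) | ∀ z : Fin n, (z ∈ W ↔ ω ∈ ⋃ s ∈ ({y} : Finset (Fin n)), openConn s z)}
                * (prodBernoulli u).real (openConnIn ((W : Set (Fin n))ᶜ) (sel W) b))) →
      ∀ sel : Finset (Fin n) → Fin n, (∀ W, sel W ∈ A) →
        ((prodBernoulli u).real (openConn a₀ b)
          + (prodBernoulli u).real ((openConn a₀ b)ᶜ ∩ (⋃ s ∈ insert y S, openConn a₀ s) ∩ (⋃ s ∈ insert y S, openConn s b))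
        ≤ (prodBernoulli u).real (⋃ s ∈ insert y S, openConn s b)
          + ∑ W ∈ (Finset.univ : Finset (Finset (Fin n))).filter (fun W => Disjoint W A),
              (prodBernoulli u).real {ω : BondConfig (Fin n) | ∀ z : Fin n, (z ∈ W ↔ ω ∈ ⋃ s ∈ insert y S, openConn s z)}
                * (prodBernoulli u).real (openConnIn ((W : Set (Fin n))ᶜ) (sel W) b)))) :
    (∀ (n : ℕ) (u : Sym2 (Fin n) → unitInterval) (A S : Finset (Fin n)) (b a₀ : Fin n)
      (sel : Finset (Fin n) → Fin n),
      b ∈ A → Disjoint S A → 2 ≤ S.card → 4 ≤ A.card → (∀ W, sel W ∈ A) → a₀ ∈ A →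
      (∀ a ∈ A, (prodBernoulli u).real (openConn a₀ b) ≤ (prodBernoulli u).real (openConn a b)) →
      (∀ v ∈ S, (prodBernoulli u).real (openConn v b) < (prodBernoulli u).real (openConn a₀ b)) →
      (∃ a ∈ A, (prodBernoulli (fun e : Sym2 (Fin n) => if (∀ x ∈ e, x ∈ S) ∧ ¬ e.IsDiag then 1 else u e)).real (openConn a b) <
        (prodBernoulli (fun e : Sym2 (Fin n) => if (∀ x ∈ e, x ∈ S) ∧ ¬ e.IsDiag then 1 else u e)).real (openConn a₀ b)) →
      (∀ w' : Sym2 (Fin n) → unitInterval,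
        (Finset.univ.filter (fun v : Fin n => ∃ z : Fin n, 0 < (w' s(z, v) : ℝ))).card ≤
          (Finset.univ.filter (fun v : Fin n => ∃ z : Fin n,
            0 < ((fun e : Sym2 (Fin n) => if (∀ x ∈ e, x ∈ S) ∧ ¬ e.IsDiag then 1 else u e) s(z, v) : ℝ))).card →
        ∀ (A' : Finset (Fin n)) (o' b' : Fin n), b' ∈ A' → o' ∉ A' →
        ∀ c₀ : Fin n, c₀ ∈ A' →
          (∀ c ∈ A', (prodBernoulli (fun e : Sym2 (Fin n) => if o' ∈ e then (0 : unitInterval) else w' e)).real (openConn c₀ b') ≤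
            (prodBernoulli (fun e : Sym2 (Fin n) => if o' ∈ e then (0 : unitInterval) else w' e)).real (openConn c b')) →
          ∀ sel' : Finset (Fin n) → Fin n, (∀ W', sel' W' ∈ A') →
          (prodBernoulli w').real (openConn c₀ b') ≤
            (prodBernoulli w').real (openConn o' b')
              + ∑ W' ∈ (Finset.univ : Finset (Finset (Fin n))).filter (fun W' => o' ∈ W' ∧ Disjoint W' A'),
                  (prodBernoulli w').real {ω : BondConfig (Fin n) | openCluster ω o' = (W' : Set (Fin n))}
                    * (prodBernoulli w').real (openConnIn ((W' : Set (Fin n))ᶜ) (sel' W') b')) →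
      ((prodBernoulli u).real (openConn a₀ b)
          + (prodBernoulli u).real ((openConn a₀ b)ᶜ ∩ (⋃ s ∈ S, openConn a₀ s) ∩ (⋃ s ∈ S, openConn s b))
        ≤ (prodBernoulli u).real (⋃ s ∈ S, openConn s b)
          + ∑ W ∈ (Finset.univ : Finset (Finset (Fin n))).filter (fun W => Disjoint W A),
              (prodBernoulli u).real {ω : BondConfig (Fin n) | ∀ z : Fin n, (z ∈ W ↔ ω ∈ ⋃ s ∈ S, openConn s z)}
                * (prodBernoulli u).real (openConnIn ((W : Set (Fin n))ᶜ) (sel W) b))) := by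
  intro n u A S b a₀ sel hb hSA h2 hA4 hsel ha₀ hmin hbad hdrift IH9
  -- singletons: goodness of {y} for every y ∈ S and every selection
  have hsingle : ∀ y ∈ S, ∀ sel' : Finset (Fin n) → Fin n, (∀ W, sel' W ∈ A) →
      ((prodBernoulli u).real (openConn a₀ b)
          + (prodBernoulli u).real ((openConn a₀ b)ᶜ ∩ (⋃ s ∈ ({y} : Finset (Fin n)), openConn a₀ s) ∩ (⋃ s ∈ ({y} : Finset (Fin n)), openConn s b))
        ≤ (prodBernoulli u).real (⋃ s ∈ ({y} : Finset (Fin n)), openConn s b)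
          + ∑ W ∈ (Finset.univ : Finset (Finset (Fin n))).filter (fun W => Disjoint W A),
              (prodBernoulli u).real {ω : BondConfig (Fin n) | ∀ z : Fin n, (z ∈ W ↔ ω ∈ ⋃ s ∈ ({y} : Finset (Fin n)), openConn s z)}
                * (prodBernoulli u).real (openConnIn ((W : Set (Fin n))ᶜ) (sel' W) b)) := by
    intro y hy sel' hsel'
    have hyA : y ∉ A := Finset.disjoint_left.1 hSA hy
    have hcard : (Finset.univ.filter (fun v : Fin n => ∃ z : Fin n, 0 < (u s(z, v) : ℝ))).card ≤
        (Finset.univ.filter (fun v : Fin n => ∃ z : Fin n,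
          0 < ((fun e : Sym2 (Fin n) => if (∀ x ∈ e, x ∈ S) ∧ ¬ e.IsDiag then 1 else u e) s(z, v) : ℝ))).card := mergeStep_card_le_glue u S
    have hQ := IH9 u hcard A y b hb hyA
    obtain ⟨a', ha', hmin'⟩ := Finset.exists_min_image A
      (fun a => (prodBernoulli (fun e : Sym2 (Fin n) => if y ∈ e then (0 : unitInterval) else u e)).real
        (openConn a b)) ⟨b, hb⟩
    have hdes := hQ a' ha' hmin' sel' hsel'
    refine blockKernel_of_designated u A {y} b a₀ a' y sel' (Finset.mem_singleton_self y) ?_ ?_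
    · rw [goodStep24_glue_singleton u y]
      exact hmin a' ha'
    · rw [goodStep24_glue_singleton u y]
      exact hdes
  -- induction on the size of the sub-block
  have main : ∀ k : ℕ, ∀ S' : Finset (Fin n), S' ⊆ S → S'.card = k + 1 →
      ∀ sel' : Finset (Fin n) → Fin n, (∀ W, sel' W ∈ A) →
      ((prodBernoulli u).real (openConn a₀ b)
          + (prodBernoulli u).real ((openConn a₀ b)ᶜ ∩ (⋃ s ∈ S', openConn a₀ s) ∩ (⋃ s ∈ S', openConn s b))
        ≤ (prodBernoulli u).real (⋃ s ∈ S', openConn s b)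
          + ∑ W ∈ (Finset.univ : Finset (Finset (Fin n))).filter (fun W => Disjoint W A),
              (prodBernoulli u).real {ω : BondConfig (Fin n) | ∀ z : Fin n, (z ∈ W ↔ ω ∈ ⋃ s ∈ S', openConn s z)}
                * (prodBernoulli u).real (openConnIn ((W : Set (Fin n))ᶜ) (sel' W) b)) := by
    intro k
    induction k with
    | zero =>
      intro S' hS'S hcard1 sel' hsel'
      obtain ⟨y, rfl⟩ := Finset.card_eq_one.1 hcard1
      exact hsingle y (hS'S (Finset.mem_singleton_self y)) sel' hsel'
    | succ k ih =>
      intro S' hS'S hcardS' sel' hsel'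
      have hS'ne : S'.Nonempty := Finset.card_pos.1 (by omega)
      have hS'A : Disjoint S' A := Finset.disjoint_of_subset_left hS'S hSA
      have hcardG : (Finset.univ.filter (fun v : Fin n => ∃ z : Fin n,
            0 < ((fun e : Sym2 (Fin n) => if (∀ x ∈ e, x ∈ S') ∧ ¬ e.IsDiag then 1 else u e) s(z, v) : ℝ))).card ≤
          (Finset.univ.filter (fun v : Fin n => ∃ z : Fin n,
            0 < ((fun e : Sym2 (Fin n) => if (∀ x ∈ e, x ∈ S) ∧ ¬ e.IsDiag then 1 else u e) s(z, v) : ℝ))).card := mergeStep_card_glue_mono u S' S hS'S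
      by_cases hSD : ∀ s₀ ∈ S', ∀ a' ∈ A,
          (∀ c ∈ A, (prodBernoulli (fun e : Sym2 (Fin n) => if s₀ ∈ e then (0 : unitInterval) else (fun e : Sym2 (Fin n) => if (∀ x ∈ e, x ∈ S') ∧ ¬ e.IsDiag then 1 else u e) e)).real (openConn a' b) ≤ (prodBernoulli (fun e : Sym2 (Fin n) => if s₀ ∈ e then (0 : unitInterval) else (fun e : Sym2 (Fin n) => if (∀ x ∈ e, x ∈ S') ∧ ¬ e.IsDiag then 1 else u e) e)).real (openConn c b)) →
          (prodBernoulli (fun e : Sym2 (Fin n) => if (∀ x ∈ e, x ∈ S') ∧ ¬ e.IsDiag then 1 else u e)).real (openConn a' b) < (prodBernoulli (fun e : Sym2 (Fin n) => if (∀ x ∈ e, x ∈ S') ∧ ¬ e.IsDiag then 1 else u e)).real (openConn a₀ b)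
      swap
      · -- some switching succeeds: the designated leaf fed by IH9 at the glued graph observed from s₀
        push Not at hSD
        obtain ⟨s₀, hs₀, a', ha', hmin', hle⟩ := hSD
        have hs₀A : s₀ ∉ A := Finset.disjoint_left.1 hS'A hs₀
        have hQg := IH9 (fun e : Sym2 (Fin n) => if (∀ x ∈ e, x ∈ S') ∧ ¬ e.IsDiag then 1 else u e) hcardG A s₀ b hb hs₀A
        exact blockKernel_of_designated u A S' b a₀ a' s₀ sel' hs₀ hle (hQg a' ha' hmin' sel' hsel')
      · -- strong drift: peel the least a₀-attached vertex and merge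
        have hfree : ∃ a ∈ A, (prodBernoulli (fun e : Sym2 (Fin n) => if (∀ x ∈ e, x ∈ S') ∧ ¬ e.IsDiag then 1 else u e)).real (openConn a b) <
            (prodBernoulli (fun e : Sym2 (Fin n) => if (∀ x ∈ e, x ∈ S') ∧ ¬ e.IsDiag then 1 else u e)).real (openConn a₀ b) := by
          obtain ⟨s₀, hs₀⟩ := hS'ne
          obtain ⟨a', ha', hmin'⟩ := Finset.exists_min_image A
            (fun a => (prodBernoulli (fun e : Sym2 (Fin n) => if s₀ ∈ e then (0 : unitInterval) else (fun e : Sym2 (Fin n) => if (∀ x ∈ e, x ∈ S') ∧ ¬ e.IsDiag then 1 else u e) e)).real (openConn a b)) ⟨b, hb⟩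
          exact ⟨a', ha', hSD s₀ hs₀ a' ha' hmin'⟩
        obtain ⟨y, hyS', hymin⟩ := Finset.exists_min_image S'
          (fun s => (prodBernoulli u).real (openConn s a₀)) hS'ne
        set S'' : Finset (Fin n) := S'.erase y with hS''def
        have hyS'' : y ∉ S'' := Finset.notMem_erase y S'
        have hins : insert y S'' = S' := Finset.insert_erase hyS'
        have hS''S : S'' ⊆ S := (Finset.erase_subset y S').trans hS'S
        have hS''card : S''.card = k + 1 := by
          rw [hS''def, Finset.card_erase_of_mem hyS']; omega
        have hS''ne : S''.Nonempty := Finset.card_pos.1 (by omega)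
        have hS''A : Disjoint S'' A := Finset.disjoint_of_subset_left hS''S hSA
        have hyA : y ∉ A := Finset.disjoint_left.1 hS'A hyS'
        have hgoodS'' : ∀ sel₂ : Finset (Fin n) → Fin n, (∀ W, sel₂ W ∈ A) →
            ((prodBernoulli u).real (openConn a₀ b)
          + (prodBernoulli u).real ((openConn a₀ b)ᶜ ∩ (⋃ s ∈ S'', openConn a₀ s) ∩ (⋃ s ∈ S'', openConn s b))
        ≤ (prodBernoulli u).real (⋃ s ∈ S'', openConn s b)
          + ∑ W ∈ (Finset.univ : Finset (Finset (Fin n))).filter (fun W => Disjoint W A),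
              (prodBernoulli u).real {ω : BondConfig (Fin n) | ∀ z : Fin n, (z ∈ W ↔ ω ∈ ⋃ s ∈ S'', openConn s z)}
                * (prodBernoulli u).real (openConnIn ((W : Set (Fin n))ᶜ) (sel₂ W) b)) := fun sel₂ hsel₂ => ih S'' hS''S hS''card sel₂ hsel₂
        have hgoody := hsingle y (hS'S hyS')
        rw [← hins]
        rw [← hins] at hfree hSD hcardG
        refine hM n u A S'' b a₀ y hb hS''A hyA hyS'' hS''ne hA4 ha₀ hmin ?_ ?_ hfree hSD ?_ hgoodS'' hgoody sel' hsel'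
        · intro v hv
          rw [hins] at hv
          exact hbad v (hS'S hv)
        · intro s hs
          exact hymin s (Finset.mem_of_mem_erase hs)
        · intro w' hw' A' o' b' hb' ho'
          exact IH9 w' (hw'.trans hcardG) A' o' b' hb' ho'
  have hcardS : S.card = (S.card - 1) + 1 := by omega
  exact main (S.card - 1) S (Finset.Subset.refl S) hcardS sel hsel

/-- **Strong-drift merge step ⇒ `AdditiveGluing`** (crux stmt-CriticalPhenomena-4576). [cite: KozmaNitzan2024, §3.2, Conjecture 1 (p. 3)] -/
theorem additiveGluing_of_mergeStepSD :
    (∀ (n : ℕ) (u : Sym2 (Fin n) → unitInterval) (A S : Finset (Fin n)) (b a₀ y : Fin n),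
      b ∈ A → Disjoint S A → y ∉ A → y ∉ S → S.Nonempty → 4 ≤ A.card → a₀ ∈ A →
      (∀ a ∈ A, (prodBernoulli u).real (openConn a₀ b) ≤ (prodBernoulli u).real (openConn a b)) →
      (∀ v ∈ insert y S, (prodBernoulli u).real (openConn v b) < (prodBernoulli u).real (openConn a₀ b)) →
      (∀ s ∈ S, (prodBernoulli u).real (openConn y a₀) ≤ (prodBernoulli u).real (openConn s a₀)) →
      (∃ a ∈ A, (prodBernoulli (fun e : Sym2 (Fin n) => if (∀ x ∈ e, x ∈ insert y S) ∧ ¬ e.IsDiag then 1 else u e)).real (openConn a b) <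
        (prodBernoulli (fun e : Sym2 (Fin n) => if (∀ x ∈ e, x ∈ insert y S) ∧ ¬ e.IsDiag then 1 else u e)).real (openConn a₀ b)) →
      (∀ s₀ ∈ insert y S, ∀ a' ∈ A,
        (∀ c ∈ A, (prodBernoulli (fun e : Sym2 (Fin n) => if s₀ ∈ e then (0 : unitInterval) else (fun e : Sym2 (Fin n) => if (∀ x ∈ e, x ∈ insert y S) ∧ ¬ e.IsDiag then 1 else u e) e)).real (openConn a' b) ≤ (prodBernoulli (fun e : Sym2 (Fin n) => if s₀ ∈ e then (0 : unitInterval) else (fun e : Sym2 (Fin n) => if (∀ x ∈ e, x ∈ insert y S) ∧ ¬ e.IsDiag then 1 else u e) e)).real (openConn c b)) →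
        (prodBernoulli (fun e : Sym2 (Fin n) => if (∀ x ∈ e, x ∈ insert y S) ∧ ¬ e.IsDiag then 1 else u e)).real (openConn a' b) < (prodBernoulli (fun e : Sym2 (Fin n) => if (∀ x ∈ e, x ∈ insert y S) ∧ ¬ e.IsDiag then 1 else u e)).real (openConn a₀ b)) →
      (∀ w' : Sym2 (Fin n) → unitInterval,
        (Finset.univ.filter (fun v : Fin n => ∃ z : Fin n, 0 < (w' s(z, v) : ℝ))).card ≤
          (Finset.univ.filter (fun v : Fin n => ∃ z : Fin n,
            0 < ((fun e : Sym2 (Fin n) => if (∀ x ∈ e, x ∈ insert y S) ∧ ¬ e.IsDiag then 1 else u e) s(z, v) : ℝ))).card →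
        ∀ (A' : Finset (Fin n)) (o' b' : Fin n), b' ∈ A' → o' ∉ A' →
        ∀ c₀ : Fin n, c₀ ∈ A' →
          (∀ c ∈ A', (prodBernoulli (fun e : Sym2 (Fin n) => if o' ∈ e then (0 : unitInterval) else w' e)).real (openConn c₀ b') ≤
            (prodBernoulli (fun e : Sym2 (Fin n) => if o' ∈ e then (0 : unitInterval) else w' e)).real (openConn c b')) →
          ∀ sel' : Finset (Fin n) → Fin n, (∀ W', sel' W' ∈ A') →
          (prodBernoulli w').real (openConn c₀ b') ≤
            (prodBernoulli w').real (openConn o' b')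
              + ∑ W' ∈ (Finset.univ : Finset (Finset (Fin n))).filter (fun W' => o' ∈ W' ∧ Disjoint W' A'),
                  (prodBernoulli w').real {ω : BondConfig (Fin n) | openCluster ω o' = (W' : Set (Fin n))}
                    * (prodBernoulli w').real (openConnIn ((W' : Set (Fin n))ᶜ) (sel' W') b')) →
      (∀ sel : Finset (Fin n) → Fin n, (∀ W, sel W ∈ A) →
        ((prodBernoulli u).real (openConn a₀ b)
          + (prodBernoulli u).real ((openConn a₀ b)ᶜ ∩ (⋃ s ∈ S, openConn a₀ s) ∩ (⋃ s ∈ S, openConn s b))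
        ≤ (prodBernoulli u).real (⋃ s ∈ S, openConn s b)
          + ∑ W ∈ (Finset.univ : Finset (Finset (Fin n))).filter (fun W => Disjoint W A),
              (prodBernoulli u).real {ω : BondConfig (Fin n) | ∀ z : Fin n, (z ∈ W ↔ ω ∈ ⋃ s ∈ S, openConn s z)}
                * (prodBernoulli u).real (openConnIn ((W : Set (Fin n))ᶜ) (sel W) b))) →
      (∀ sel : Finset (Fin n) → Fin n, (∀ W, sel W ∈ A) →
        ((prodBernoulli u).real (openConn a₀ b)
          + (prodBernoulli u).real ((openConn a₀ b)ᶜ ∩ (⋃ s ∈ ({y} : Finset (Fin n)), openConn a₀ s) ∩ (⋃ s ∈ ({y} : Finset (Fin n)), openConn s b))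
        ≤ (prodBernoulli u).real (⋃ s ∈ ({y} : Finset (Fin n)), openConn s b)
          + ∑ W ∈ (Finset.univ : Finset (Finset (Fin n))).filter (fun W => Disjoint W A),
              (prodBernoulli u).real {ω : BondConfig (Fin n) | ∀ z : Fin n, (z ∈ W ↔ ω ∈ ⋃ s ∈ ({y} : Finset (Fin n)), openConn s z)}
                * (prodBernoulli u).real (openConnIn ((W : Set (Fin n))ᶜ) (sel W) b))) →
      ∀ sel : Finset (Fin n) → Fin n, (∀ W, sel W ∈ A) →
        ((prodBernoulli u).real (openConn a₀ b)
          + (prodBernoulli u).real ((openConn a₀ b)ᶜ ∩ (⋃ s ∈ insert y S, openConn a₀ s) ∩ (⋃ s ∈ insert y S, openConn s b))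
        ≤ (prodBernoulli u).real (⋃ s ∈ insert y S, openConn s b)
          + ∑ W ∈ (Finset.univ : Finset (Finset (Fin n))).filter (fun W => Disjoint W A),
              (prodBernoulli u).real {ω : BondConfig (Fin n) | ∀ z : Fin n, (z ∈ W ↔ ω ∈ ⋃ s ∈ insert y S, openConn s z)}
                * (prodBernoulli u).real (openConnIn ((W : Set (Fin n))ᶜ) (sel W) b))) →
    Summit.CriticalPhenomena.PercolationContinuityZ3.Theses.PercNearOneGluing.AdditiveGluing := fun hM =>
  additiveGluing_of_residualKernelQ9 (residualKernelQ9_of_mergeStepSD hM)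

/-- **Strong-drift merge step ⇒ `NoHeavyLowerTail`** (crux stmt-CriticalPhenomena-4575). [cite: KozmaNitzan2024, Conjecture 3 (p. 15)] -/
theorem noHeavyLowerTail_of_mergeStepSD :
    (∀ (n : ℕ) (u : Sym2 (Fin n) → unitInterval) (A S : Finset (Fin n)) (b a₀ y : Fin n),
      b ∈ A → Disjoint S A → y ∉ A → y ∉ S → S.Nonempty → 4 ≤ A.card → a₀ ∈ A →
      (∀ a ∈ A, (prodBernoulli u).real (openConn a₀ b) ≤ (prodBernoulli u).real (openConn a b)) →
      (∀ v ∈ insert y S, (prodBernoulli u).real (openConn v b) < (prodBernoulli u).real (openConn a₀ b)) →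
      (∀ s ∈ S, (prodBernoulli u).real (openConn y a₀) ≤ (prodBernoulli u).real (openConn s a₀)) →
      (∃ a ∈ A, (prodBernoulli (fun e : Sym2 (Fin n) => if (∀ x ∈ e, x ∈ insert y S) ∧ ¬ e.IsDiag then 1 else u e)).real (openConn a b) <
        (prodBernoulli (fun e : Sym2 (Fin n) => if (∀ x ∈ e, x ∈ insert y S) ∧ ¬ e.IsDiag then 1 else u e)).real (openConn a₀ b)) →
      (∀ s₀ ∈ insert y S, ∀ a' ∈ A,
        (∀ c ∈ A, (prodBernoulli (fun e : Sym2 (Fin n) => if s₀ ∈ e then (0 : unitInterval) else (fun e : Sym2 (Fin n) => if (∀ x ∈ e, x ∈ insert y S) ∧ ¬ e.IsDiag then 1 else u e) e)).real (openConn a' b) ≤ (prodBernoulli (fun e : Sym2 (Fin n) => if s₀ ∈ e then (0 : unitInterval) else (fun e : Sym2 (Fin n) => if (∀ x ∈ e, x ∈ insert y S) ∧ ¬ e.IsDiag then 1 else u e) e)).real (openConn c b)) →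
        (prodBernoulli (fun e : Sym2 (Fin n) => if (∀ x ∈ e, x ∈ insert y S) ∧ ¬ e.IsDiag then 1 else u e)).real (openConn a' b) < (prodBernoulli (fun e : Sym2 (Fin n) => if (∀ x ∈ e, x ∈ insert y S) ∧ ¬ e.IsDiag then 1 else u e)).real (openConn a₀ b)) →
      (∀ w' : Sym2 (Fin n) → unitInterval,
        (Finset.univ.filter (fun v : Fin n => ∃ z : Fin n, 0 < (w' s(z, v) : ℝ))).card ≤
          (Finset.univ.filter (fun v : Fin n => ∃ z : Fin n,
            0 < ((fun e : Sym2 (Fin n) => if (∀ x ∈ e, x ∈ insert y S) ∧ ¬ e.IsDiag then 1 else u e) s(z, v) : ℝ))).card →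
        ∀ (A' : Finset (Fin n)) (o' b' : Fin n), b' ∈ A' → o' ∉ A' →
        ∀ c₀ : Fin n, c₀ ∈ A' →
          (∀ c ∈ A', (prodBernoulli (fun e : Sym2 (Fin n) => if o' ∈ e then (0 : unitInterval) else w' e)).real (openConn c₀ b') ≤
            (prodBernoulli (fun e : Sym2 (Fin n) => if o' ∈ e then (0 : unitInterval) else w' e)).real (openConn c b')) →
          ∀ sel' : Finset (Fin n) → Fin n, (∀ W', sel' W' ∈ A') →
          (prodBernoulli w').real (openConn c₀ b') ≤
            (prodBernoulli w').real (openConn o' b')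
              + ∑ W' ∈ (Finset.univ : Finset (Finset (Fin n))).filter (fun W' => o' ∈ W' ∧ Disjoint W' A'),
                  (prodBernoulli w').real {ω : BondConfig (Fin n) | openCluster ω o' = (W' : Set (Fin n))}
                    * (prodBernoulli w').real (openConnIn ((W' : Set (Fin n))ᶜ) (sel' W') b')) →
      (∀ sel : Finset (Fin n) → Fin n, (∀ W, sel W ∈ A) →
        ((prodBernoulli u).real (openConn a₀ b)
          + (prodBernoulli u).real ((openConn a₀ b)ᶜ ∩ (⋃ s ∈ S, openConn a₀ s) ∩ (⋃ s ∈ S, openConn s b))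
        ≤ (prodBernoulli u).real (⋃ s ∈ S, openConn s b)
          + ∑ W ∈ (Finset.univ : Finset (Finset (Fin n))).filter (fun W => Disjoint W A),
              (prodBernoulli u).real {ω : BondConfig (Fin n) | ∀ z : Fin n, (z ∈ W ↔ ω ∈ ⋃ s ∈ S, openConn s z)}
                * (prodBernoulli u).real (openConnIn ((W : Set (Fin n))ᶜ) (sel W) b))) →
      (∀ sel : Finset (Fin n) → Fin n, (∀ W, sel W ∈ A) →
        ((prodBernoulli u).real (openConn a₀ b)
          + (prodBernoulli u).real ((openConn a₀ b)ᶜ ∩ (⋃ s ∈ ({y} : Finset (Fin n)), openConn a₀ s) ∩ (⋃ s ∈ ({y} : Finset (Fin n)), openConn s b))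
        ≤ (prodBernoulli u).real (⋃ s ∈ ({y} : Finset (Fin n)), openConn s b)
          + ∑ W ∈ (Finset.univ : Finset (Finset (Fin n))).filter (fun W => Disjoint W A),
              (prodBernoulli u).real {ω : BondConfig (Fin n) | ∀ z : Fin n, (z ∈ W ↔ ω ∈ ⋃ s ∈ ({y} : Finset (Fin n)), openConn s z)}
                * (prodBernoulli u).real (openConnIn ((W : Set (Fin n))ᶜ) (sel W) b))) →
      ∀ sel : Finset (Fin n) → Fin n, (∀ W, sel W ∈ A) →
        ((prodBernoulli u).real (openConn a₀ b)
          + (prodBernoulli u).real ((openConn a₀ b)ᶜ ∩ (⋃ s ∈ insert y S, openConn a₀ s) ∩ (⋃ s ∈ insert y S, openConn s b))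
        ≤ (prodBernoulli u).real (⋃ s ∈ insert y S, openConn s b)
          + ∑ W ∈ (Finset.univ : Finset (Finset (Fin n))).filter (fun W => Disjoint W A),
              (prodBernoulli u).real {ω : BondConfig (Fin n) | ∀ z : Fin n, (z ∈ W ↔ ω ∈ ⋃ s ∈ insert y S, openConn s z)}
                * (prodBernoulli u).real (openConnIn ((W : Set (Fin n))ᶜ) (sel W) b))) →
    Summit.CriticalPhenomena.PercolationContinuityZ3.Theses.PercNearOneGluing.NoHeavyLowerTail := fun hM =>
  noHeavyLowerTail_of_manyFingersLargePocket
    (manyFingersLargePocket_of_nearOneGluing (additiveGluingSuffices_proof (additiveGluing_of_mergeStepSD hM)))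

end MergeStepSD

end

end Summit.CriticalPhenomena.PercolationContinuityZ3.Theorems
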